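import Summits.QuantumFields.YangMills.Theorems.SwapVirialDeficitBlowUpLeaderChart
import Summits.QuantumFields.YangMills.Theorems.SwapVirialDeficitZeroModeGroupFourSmallBallScaling
import HarnessLib

/-!
# The PERIODIC massive-mode rung, brick PJ2: the LEADER CHART of the zero-flux ring — fcl-p3 g44's K4 chain (cone ∕ arrange ∕ straighten ∕ `D_t³`)
# run for conjugation-invariant INTEGRANDS on `SU(2)⁴`, exact Jacobian `t⁶`
# (free-hands support of ⟨stmt-QuantumFields-24196⟩ `SwapVirialDeficit.ToronSoftnessSharp`; periodic twin of fcl-p3 g45's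
# ✓`BlowUp.lintegral_haar_four_eq_leaderChart` (J2, `t⁷`, σ-glued ring); target named by ✓`PeriodicRing.tendsto_periodicMeanAction_of_principalLogLimit`)

The four leaders of the PERIODIC femto ring (three wrap links and the seam value) have NO slaved letter: flat configurations are four pairwise
commuting letters (zero-mode block ✓`ZeroModeGroup.tendsto_haar_nearlyCommuting_div_log`, `≍ t⁶·log(1/t)`).  fcl-p3 g44's chain
✓`haar_nearlyCommuting_eq_lintegral_phiFour` → ✓`phiFour_eq_axis` → ✓`phiFour_axis_eq_scaled` transports the EVENT `N₄(t)`; the joint blow-up of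
the full periodic ring deficit needs it for a general measurable `f ≥ 0` on `SU(2)⁴` invariant under simultaneous conjugation (the follower integral of a
gauge-invariant functional):
* §1 `rawLetters q = ![Q x, Q z, Q y, Q a]` and `axialLetters q = ![Q x, Q z, Q y, Q (axisPoint a)]` in w3 g63's arranged coordinates `q = (a, ((x, y), z))`
  (✓`arrange`: hub `a` = letter `3`), measurability, ★ `quatToSU2_radialUnit`, ★ `quatToSU2_axisPoint_eq_conj` (the straightened hub);
* §2 ★ `lintegral_haar_four_eq_raw` (✓`measurePreserving_proj`, ✓`measurePreserving_arrange`), ★★ `lintegral_raw_eq_axial` (✓`measurePreserving_straighten`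
  + the invariance, a.e. on ✓`ae_coneFour_good`), ★★ `lintegral_haar_four_eq_axial_hub` (hub Tonelli: `∫ f dHaar⁴ = ∫dcone(a) ∫ f (axialLetters (a, w)) dconeThree`);
* §3 the transverse dilation of ALL THREE non-hub letters `dil3P t = D_t × D_t × D_t` (✓`ZeroModeGroup.dilate`, `det = t⁶`, ✓`map_dilate3_volume`):
  ★ `lintegral_volume3_eq_dil3P` (`∫ H = t⁶·∫ H ∘ dil3P t`) and ★★★ `lintegral_haar_four_eq_periodicLeaderChart`:
  `∫ f dHaar⁴ = ofReal(coneConst³·t⁶) · ∫dcone(a) ∫ 𝟙_{B³}(dil3P t w) · f (axialLetters (a, dil3P t w)) dw` for EVERY `t > 0`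
  (with `f = 𝟙_{N₄(t)}` this is ✓`haar_nearlyCommuting_eq_scaled`).
The logarithm of the periodic law is NOT in this Jacobian: it lives in the hub integral (two-scale structure of ✓`…FourSmallBallTwoScale`), to be handled
by a log-shell.  Deliberately NOT here: followers (✓J1 applies verbatim), the periodic ring chart, dominator, log-shell.
HONEST LABEL: generic measure theory on `SU(2)⁴` (plumbing for a plan-level fixed-`L` rung of a DRAFT line); NOT ⟨24196⟩/⟨24497⟩; own crux ⟨22884⟩ OPEN
(blocked-on ⟨19935⟩); the Yang–Mills mass gap is NOT proved; no summit is proved by a line.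
Width seat ym-line-sfw-p2-w3 g64 (cell ym-idea-1, free hands), `--supports stmt-QuantumFields-24196`.  Three `def`s (`rawLetters`, `axialLetters`, `dil3P`),
standard axioms, 0 `sorry`.  References: [cite: Luscher1983, §2]; [cite: GonzalezarroyoAltes1988]; [folklore].
-/

set_option autoImplicit false

noncomputable section

open MeasureTheory Quaternion Set
open scoped Quaternion ENNReal BigOperators
open Literature.MathematicalPhysics.QuantumLattice
open Literature.MathematicalPhysics.QuantumFieldTheory (haarProbability)
open Literature.MathematicalPhysics.QuantumFieldTheory.Balaban1983to89.T4HaarSU2Translate (su2Quat_quatToSU2)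
open Literature.Analysis.Calculus (radialUnit radialUnit_def norm_radialUnit)
open Summit.QuantumFields.YangMills.Theorems.SwapTwistDeficit.ToronLog
open Summit.QuantumFields.YangMills.Theorems.SwapVirialDeficit.ZeroModeGroup
open Summit.QuantumFields.YangMills.Theorems.SwapVirialDeficit.ZeroModeSigma

attribute [local instance] Literature.Analysis.FluidPDE.Tao2016.quatMeasurableSpace
  Literature.Analysis.FluidPDE.Tao2016.quatBorelSpace
  Literature.MathematicalPhysics.QuantumLattice.secondCountableTopology_su2

namespace Summit.QuantumFields.YangMills.Theorems.SwapVirialDeficit.BlowUp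

/-! ## §1 Raw and axial letters in the arranged coordinates -/

/-- The radial projection only sees the unit vector: `quatToSU2 (radialUnit v) = quatToSU2 v` (both junk `1` at `v = 0`). [folklore] -/
theorem quatToSU2_radialUnit (v : ℍ) : quatToSU2 (radialUnit v) = quatToSU2 v := by
  by_cases hv : v = 0
  · subst hv; simp [radialUnit_def]
  · rw [radialUnit_def]
    exact quatToSU2_smul (inv_pos.2 (norm_pos_iff.2 hv)) v

/-- The RAW letters in w3 g63's arranged coordinates `q = (a, ((x, y), z))` (✓`arrange`: hub `a = v 3`, pair `(x, y) = (v 0, v 2)`, `z = v 1`):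
`![Q x, Q z, Q y, Q a]`. [folklore] -/
def rawLetters (q : ℍ × ((ℍ × ℍ) × ℍ)) : Fin 4 → Matrix.specialUnitaryGroup (Fin 2) ℂ :=
  ![quatToSU2 q.2.1.1, quatToSU2 q.2.2, quatToSU2 q.2.1.2, quatToSU2 q.1]

/-- Unfolding `rawLetters`. [folklore] -/
theorem rawLetters_def (q : ℍ × ((ℍ × ℍ) × ℍ)) : rawLetters q = ![quatToSU2 q.2.1.1, quatToSU2 q.2.2, quatToSU2 q.2.1.2, quatToSU2 q.1] := rfl

/-- `rawLetters ∘ arrange = quatToSU2 ∘ ·`. [folklore] -/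
theorem rawLetters_arrange (v : Fin 4 → ℍ) : rawLetters (arrange v) = fun μ => quatToSU2 (v μ) := by
  funext μ
  fin_cases μ <;> rfl

/-- `rawLetters` is measurable. [folklore] -/
theorem measurable_rawLetters : Measurable rawLetters :=
  measurable_vec4 (measurable_quatToSU2.comp (measurable_fst.comp (measurable_fst.comp measurable_snd)))
    (measurable_quatToSU2.comp (measurable_snd.comp measurable_snd))
    (measurable_quatToSU2.comp (measurable_snd.comp (measurable_fst.comp measurable_snd))) (measurable_quatToSU2.comp measurable_fst)

/-- ★ **The AXIAL letters** — the periodic leader tuple at a blow-up point: raw non-hub letters, hub replaced by its axial representative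
`Q (axisPoint a)`, `axisPoint a = re a + ‖Im a‖·i` (four pairwise commuting letters when `x, y, z` are axial too). [folklore] -/
def axialLetters (q : ℍ × ((ℍ × ℍ) × ℍ)) : Fin 4 → Matrix.specialUnitaryGroup (Fin 2) ℂ :=
  ![quatToSU2 q.2.1.1, quatToSU2 q.2.2, quatToSU2 q.2.1.2, quatToSU2 (axisPoint q.1)]

/-- Unfolding `axialLetters`. [folklore] -/
theorem axialLetters_def (q : ℍ × ((ℍ × ℍ) × ℍ)) :
    axialLetters q = ![quatToSU2 q.2.1.1, quatToSU2 q.2.2, quatToSU2 q.2.1.2, quatToSU2 (axisPoint q.1)] := rfl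

/-- `axialLetters` is measurable. [folklore] -/
theorem measurable_axialLetters : Measurable axialLetters :=
  measurable_vec4 (measurable_quatToSU2.comp (measurable_fst.comp (measurable_fst.comp measurable_snd)))
    (measurable_quatToSU2.comp (measurable_snd.comp measurable_snd))
    (measurable_quatToSU2.comp (measurable_snd.comp (measurable_fst.comp measurable_snd)))
    (measurable_quatToSU2.comp (continuous_axisPoint.measurable.comp measurable_fst))

/-- The letter-`3` of the σ-ring's ✓`leaderTuple` and of `axialLetters` agree: `Q (radialUnit (axisPoint a)) = Q (axisPoint a)`. [folklore] -/
theorem leaderTuple_three_eq_axialLetters_three (a : ℍ) (w : (ℍ × ℍ) × ℍ) : leaderTuple a w 3 = axialLetters (a, w) 3 := by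
  rw [(leaderTuple_apply a w).2.2.2]
  exact quatToSU2_radialUnit (axisPoint a)

/-- ★ **The straightened hub**: `Q (axisPoint a) = (Q u)⁻¹ · Q a · Q u`, `u = hubUnit a` (`coneQ a ≠ 0`, `a ≠ 0`; ✓`conj_hubUnit_radialUnit`). [folklore] -/
theorem quatToSU2_axisPoint_eq_conj {a : ℍ} (hqa : coneQ a ≠ 0) (ha : a ≠ 0) :
    quatToSU2 (axisPoint a) = (quatToSU2 (hubUnit a))⁻¹ * quatToSU2 a * quatToSU2 (hubUnit a) := by
  have hu : ‖hubUnit a‖ = 1 := norm_unitConeQ hqa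
  have hra : radialUnit a ≠ 0 := by
    intro h; have := norm_radialUnit ha; rw [h, norm_zero] at this; exact zero_ne_one this
  rw [← quatToSU2_radialUnit (axisPoint a), ← conj_hubUnit_radialUnit hqa, quatToSU2_conj_unit hu hra, quatToSU2_radialUnit]

/-- On the good set, straightening the three non-hub letters conjugates ALL FOUR raw letters:
`axialLetters (a, conj3 (hubUnit a) w) = fun μ ↦ U⁻¹·rawLetters (a, w) μ·U⁻¹⁻¹`, `U = Q (hubUnit a)` (`coneQ a ≠ 0`, all letters `≠ 0`). [folklore] -/
theorem axialLetters_straighten {a : ℍ} (hqa : coneQ a ≠ 0) (ha : a ≠ 0) {w : (ℍ × ℍ) × ℍ} (hx : w.1.1 ≠ 0) (hy : w.1.2 ≠ 0) (hz : w.2 ≠ 0) :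
    axialLetters (a, conj3 (hubUnit a) w) = fun μ => (quatToSU2 (hubUnit a))⁻¹ * rawLetters (a, w) μ * (quatToSU2 (hubUnit a))⁻¹⁻¹ := by
  have hu : ‖hubUnit a‖ = 1 := norm_unitConeQ hqa
  rw [inv_inv, axialLetters_def, rawLetters_def, conj3_apply]
  simp only
  rw [quatToSU2_conj_unit hu hx, quatToSU2_conj_unit hu hz, quatToSU2_conj_unit hu hy, quatToSU2_axisPoint_eq_conj hqa ha]
  funext μ
  fin_cases μ <;> rfl

/-! ## §2 The chain for conjugation-invariant integrands, up to the hub Tonelli -/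

/-- ★ **Arranged cone coordinates for integrands**: `∫ f dHaar⁴ = ∫ f (rawLetters q) dconeFour(q)` (✓`measurePreserving_proj`, ✓`measurePreserving_arrange`).
[folklore] -/
theorem lintegral_haar_four_eq_raw (f : (Fin 4 → Matrix.specialUnitaryGroup (Fin 2) ℂ) → ℝ≥0∞) (hf : Measurable f) :
    ∫⁻ C, f C ∂(Measure.pi fun _ : Fin 4 => haarProbability (Matrix.specialUnitaryGroup (Fin 2) ℂ)) = ∫⁻ q, f (rawLetters q) ∂coneFour := by
  have hm : Measurable fun q : ℍ × ((ℍ × ℍ) × ℍ) => f (rawLetters q) := hf.comp measurable_rawLetters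
  rw [← measurePreserving_proj.lintegral_comp hf, ← measurePreserving_arrange.lintegral_comp hm]
  simp only [rawLetters_arrange]

/-- ★★ **Hub straightening for integrands**: for `f` invariant under simultaneous conjugation,
`∫ f (rawLetters q) dconeFour = ∫ f (axialLetters q) dconeFour` — the hub may be taken AXIAL (✓`measurePreserving_straighten`). [folklore] -/
theorem lintegral_raw_eq_axial (f : (Fin 4 → Matrix.specialUnitaryGroup (Fin 2) ℂ) → ℝ≥0∞) (hf : Measurable f)
    (hinv : ∀ (h : Matrix.specialUnitaryGroup (Fin 2) ℂ) (C : Fin 4 → Matrix.specialUnitaryGroup (Fin 2) ℂ), f (fun μ => h * C μ * h⁻¹) = f C) :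
    ∫⁻ q, f (rawLetters q) ∂coneFour = ∫⁻ q, f (axialLetters q) ∂coneFour := by
  have hm : Measurable fun q : ℍ × ((ℍ × ℍ) × ℍ) => f (axialLetters q) := hf.comp measurable_axialLetters
  rw [← measurePreserving_straighten.lintegral_comp hm]
  refine lintegral_congr_ae ?_
  filter_upwards [ae_coneFour_good] with q hq
  obtain ⟨hqa, ha, hx, hy, hz⟩ := hq
  rw [axialLetters_straighten hqa ha hx hy hz, hinv]

/-- ★★ **Hub Tonelli for the periodic leaders**: for a measurable `f ≥ 0` on `SU(2)⁴` invariant under simultaneous conjugation,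
`∫ f dHaar⁴ = ∫ dcone(a) ∫ f (axialLetters (a, w)) dconeThree(w)`. [folklore] -/
theorem lintegral_haar_four_eq_axial_hub (f : (Fin 4 → Matrix.specialUnitaryGroup (Fin 2) ℂ) → ℝ≥0∞) (hf : Measurable f)
    (hinv : ∀ (h : Matrix.specialUnitaryGroup (Fin 2) ℂ) (C : Fin 4 → Matrix.specialUnitaryGroup (Fin 2) ℂ), f (fun μ => h * C μ * h⁻¹) = f C) :
    ∫⁻ C, f C ∂(Measure.pi fun _ : Fin 4 => haarProbability (Matrix.specialUnitaryGroup (Fin 2) ℂ)) =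
      ∫⁻ a, ∫⁻ w, f (axialLetters (a, w)) ∂coneThree ∂coneMeasure := by
  haveI := isProbabilityMeasure_coneMeasure
  haveI := isProbabilityMeasure_coneThree
  have hm : Measurable fun q : ℍ × ((ℍ × ℍ) × ℍ) => f (axialLetters q) := hf.comp measurable_axialLetters
  rw [lintegral_haar_four_eq_raw f hf, lintegral_raw_eq_axial f hf hinv, coneFour, lintegral_prod _ hm.aemeasurable]

/-! ## §3 The transverse dilation of the three non-hub letters and the exact `t⁶` -/

/-- **The product transverse dilation** `dil3P t = D_t × D_t × D_t` of the three non-hub letters (✓`ZeroModeGroup.dilate`, `det D_t = t²`), as a linear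
map of `(ℍ × ℍ) × ℍ` (fcl-p3 g44's `Prod.map (Prod.map (dilate t) (dilate t)) (dilate t)`). [folklore] -/
def dil3P (t : ℝ) : ((ℍ × ℍ) × ℍ) →ₗ[ℝ] ((ℍ × ℍ) × ℍ) := ((dilate t).prodMap (dilate t)).prodMap (dilate t)

/-- `dil3P` componentwise. [folklore] -/
theorem dil3P_apply (t : ℝ) (w : (ℍ × ℍ) × ℍ) : dil3P t w = ((dilate t w.1.1, dilate t w.1.2), dilate t w.2) := rfl

/-- `dil3P t` is fcl-p3 g44's product map. [folklore] -/
theorem dil3P_eq_prodMap (t : ℝ) : (dil3P t : (ℍ × ℍ) × ℍ → (ℍ × ℍ) × ℍ) = Prod.map (Prod.map (dilate t) (dilate t)) (dilate t) := by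
  funext w; rfl

/-- ★ `det (D_t × D_t × D_t) = t⁶` — the small-ball exponent of `N₄`. [folklore] -/
theorem det_dil3P (t : ℝ) : LinearMap.det (dil3P t) = t ^ 6 := by
  unfold dil3P
  rw [LinearMap.det_prodMap, LinearMap.det_prodMap, det_dilate]; ring

/-- `dil3P t` is measurable. [folklore] -/
theorem measurable_dil3P (t : ℝ) : Measurable (dil3P t) := (LinearMap.continuous_of_finiteDimensional _).measurable

/-- ★ **Dilation for integrands**: `∫ H dvol³ = t⁶ · ∫ H (dil3P t w) dw` (`t > 0`, measurable `H ≥ 0`). [folklore] -/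
theorem lintegral_volume3_eq_dil3P {t : ℝ} (ht : 0 < t) (H : (ℍ × ℍ) × ℍ → ℝ≥0∞) (hH : Measurable H) :
    ∫⁻ w, H w ∂(volume : Measure ((ℍ × ℍ) × ℍ)) = ENNReal.ofReal (t ^ 6) * ∫⁻ w, H (dil3P t w) ∂(volume : Measure ((ℍ × ℍ) × ℍ)) := by
  haveI := isAddHaarMeasure_volume3
  have hdet : LinearMap.det (dil3P t) ≠ 0 := by rw [det_dil3P]; positivity
  have h6 : 0 < t ^ 6 := by positivity
  have hmap : (volume : Measure ((ℍ × ℍ) × ℍ)).map (dil3P t) = ENNReal.ofReal ((t ^ 6)⁻¹) • (volume : Measure ((ℍ × ℍ) × ℍ)) := by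
    rw [Measure.map_linearMap_addHaar_eq_smul_addHaar volume hdet, det_dil3P, abs_inv, abs_of_pos h6]
  have h1 : ∫⁻ w, H (dil3P t w) ∂(volume : Measure ((ℍ × ℍ) × ℍ)) = ∫⁻ w, H w ∂((volume : Measure ((ℍ × ℍ) × ℍ)).map (dil3P t)) :=
    (lintegral_map hH (measurable_dil3P t)).symm
  rw [h1, hmap, lintegral_smul_measure, smul_eq_mul, ← mul_assoc, ← ENNReal.ofReal_mul h6.le, mul_inv_cancel₀ h6.ne',
    ENNReal.ofReal_one, one_mul]

/-- For fixed hub `a`, `w ↦ axialLetters (a, w)` is measurable. [folklore] -/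
theorem measurable_axialLetters_right (a : ℍ) : Measurable fun w : (ℍ × ℍ) × ℍ => axialLetters (a, w) :=
  measurable_axialLetters.comp (measurable_const.prodMk measurable_id)

/-- The blown-up hub integrand `a ↦ ∫ 𝟙_{B³}(dil3P t w) f (axialLetters (a, dil3P t w)) dw` is measurable. [folklore] -/
theorem measurable_lintegral_axial_dil3P (f : (Fin 4 → Matrix.specialUnitaryGroup (Fin 2) ℂ) → ℝ≥0∞) (hf : Measurable f) (t : ℝ) :
    Measurable fun a : ℍ => ∫⁻ w, ball3.indicator (fun w' => f (axialLetters (a, w'))) (dil3P t w) ∂(volume : Measure ((ℍ × ℍ) × ℍ)) := by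
  have hF : Measurable fun q : ℍ × ((ℍ × ℍ) × ℍ) => ball3.indicator (fun w' => f (axialLetters (q.1, w'))) (dil3P t q.2) := by
    have h1 : Measurable fun q : ℍ × ((ℍ × ℍ) × ℍ) => f (axialLetters (q.1, dil3P t q.2)) :=
      hf.comp (measurable_axialLetters.comp (measurable_fst.prodMk ((measurable_dil3P t).comp measurable_snd)))
    have h2 : MeasurableSet {q : ℍ × ((ℍ × ℍ) × ℍ) | dil3P t q.2 ∈ ball3} := measurableSet_ball3.preimage ((measurable_dil3P t).comp measurable_snd)
    have e : (fun q : ℍ × ((ℍ × ℍ) × ℍ) => ball3.indicator (fun w' => f (axialLetters (q.1, w'))) (dil3P t q.2)) =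
        {q : ℍ × ((ℍ × ℍ) × ℍ) | dil3P t q.2 ∈ ball3}.indicator (fun q => f (axialLetters (q.1, dil3P t q.2))) := by
      funext q
      by_cases h : dil3P t q.2 ∈ ball3
      · rw [Set.indicator_of_mem h, Set.indicator_of_mem (show q ∈ {q' : ℍ × ((ℍ × ℍ) × ℍ) | dil3P t q'.2 ∈ ball3} from h)]
      · rw [Set.indicator_of_notMem h, Set.indicator_of_notMem (show q ∉ {q' : ℍ × ((ℍ × ℍ) × ℍ) | dil3P t q'.2 ∈ ball3} from h)]
    rw [e]
    exact h1.indicator h2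
  exact hF.lintegral_prod_right'

/-- ★★★ **THE PERIODIC LEADER CHART**: for a measurable `f ≥ 0` on `SU(2)⁴` invariant under simultaneous conjugation and every scale `t > 0`,
`∫ f dHaar⁴ = ofReal(coneConst³·t⁶) · ∫dcone(a) ∫ 𝟙_{B³}(dil3P t w) · f (axialLetters (a, dil3P t w)) dw` — hub axial, the three non-hub letters
transversally dilated; EXACT, the leader factor `t⁶ = u³` of the Jacobian `u^{9L⁴−3/2}` of the periodic joint blow-up (with the followers' `t^{3(6L⁴−3)}`
of ✓`lintegral_haar_pi_eq_followerChart`: `6 + 18L⁴ − 9 = 2·(9L⁴ − 3/2)`).  With `f = 𝟙_{N₄(t)}` this is ✓`haar_nearlyCommuting_eq_scaled`.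
[cite: Luscher1983, §2] [cite: GonzalezarroyoAltes1988] -/
theorem lintegral_haar_four_eq_periodicLeaderChart (f : (Fin 4 → Matrix.specialUnitaryGroup (Fin 2) ℂ) → ℝ≥0∞) (hf : Measurable f)
    (hinv : ∀ (h : Matrix.specialUnitaryGroup (Fin 2) ℂ) (C : Fin 4 → Matrix.specialUnitaryGroup (Fin 2) ℂ), f (fun μ => h * C μ * h⁻¹) = f C)
    {t : ℝ} (ht : 0 < t) :
    ∫⁻ C, f C ∂(Measure.pi fun _ : Fin 4 => haarProbability (Matrix.specialUnitaryGroup (Fin 2) ℂ)) =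
      ENNReal.ofReal (coneConst ^ 3 * t ^ 6) *
        ∫⁻ a, ∫⁻ w, ball3.indicator (fun w' => f (axialLetters (a, w'))) (dil3P t w) ∂(volume : Measure ((ℍ × ℍ) × ℍ)) ∂coneMeasure := by
  have hm := measurable_lintegral_axial_dil3P f hf t
  rw [lintegral_haar_four_eq_axial_hub f hf hinv]
  -- the inner `coneThree` integral at a fixed hub: restrict to the ball, then dilate
  have hin : ∀ a : ℍ, ∫⁻ w, f (axialLetters (a, w)) ∂coneThree =
      ENNReal.ofReal coneConst ^ 3 * (ENNReal.ofReal (t ^ 6) *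
        ∫⁻ w, ball3.indicator (fun w' => f (axialLetters (a, w'))) (dil3P t w) ∂(volume : Measure ((ℍ × ℍ) × ℍ))) := by
    intro a
    have hg : Measurable fun w : (ℍ × ℍ) × ℍ => f (axialLetters (a, w)) := hf.comp (measurable_axialLetters_right a)
    rw [ZeroModeSigma.coneThree_eq_smul_restrict, lintegral_smul_measure, smul_eq_mul, ← lintegral_indicator measurableSet_ball3,
      lintegral_volume3_eq_dil3P ht _ (hg.indicator measurableSet_ball3)]
  simp only [hin]
  have hc : 0 ≤ coneConst := coneConst_pos.le
  rw [lintegral_const_mul _ (hm.const_mul _), lintegral_const_mul _ hm, ← mul_assoc, ENNReal.ofReal_mul (pow_nonneg hc 3),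
    ENNReal.ofReal_pow hc]

end Summit.QuantumFields.YangMills.Theorems.SwapVirialDeficit.BlowUp

end
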